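import Literature.NumberTheory.EllipticCurves.ZpExtensionScalarTwistMaps
import Literature.NumberTheory.GaloisRepresentations.DiscreteModuleInverseLimit
import HarnessLib

/-!
# Howard's compact module `T_𝔮 = lim_k (M_k ⊗ A_{m,k}(ψ))` at an Eisenstein prime `𝔮 = (T^m + p)` as an
# inverse system of discrete Galois modules and its limit representation
# (definitions with bodies + unfolding lemmas; no named fact; instances only on the new type synonym `EisensteinLevel`; no notation)

Topic `NumberTheory/EllipticCurves` (companion of `ZpExtensionScalarTwist`/`…Maps`; consumer vocabulary:
`GaloisRepresentations/DiscreteModuleInverseLimit{,H1,H2}` — `DiscreteInvSystem`, `limitRep`, `cohomologyLimit`,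
`H^q_cont(G, lim M_n) ≃ lim H^q(G, M_n)`).

Howard [Howard 2004, §2.2, Def. 2.2.3, proof of Thm. 2.2.10]: `T_𝔮 = 𝐓 ⊗_Λ S_𝔮 = lim_k T_𝔮/p^k T_𝔮` is a compact
`S_𝔮[Γ_K]`-module and `H¹(K, T_𝔮)` its continuous cohomology. With the finite levels
`κ.eisensteinTwist (ρ k) hm k` (`M_k ⊗ A_{m,k}(ψ)`; `M_k = E[p^k]` for `E`) and the reductions
`κ.eisensteinTwistReduce hm hkk' (t hkk')` of the tree, this file packages:

* `ZpExtension.EisensteinLevel p m M k` — type synonym of the level carrier `M_k ⊗ A_{m,k}` with its own instances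
  (needed for instance search under the binder `k`), including the `Λ`- and `S_𝔮 = Λ/(q_m)`-module structures through
  `Λ ↠ S_𝔮 ↠ A_{m,k}` (`instModuleIwasawa`, `instModuleQuotient`; `Γ_K` and the transitions act linearly:
  `eisensteinInvSystem_ρ_apply_{iwasawa,quotient}_smul`, `eisensteinInvSystem_red_{iwasawa,quotient}_smul`) —
  the `Mod_{R,K}` shape «discrete module + `Module R` + linearity» of Howard §1.1 for `R = S_𝔮`;
* `ZpExtension.eisensteinInvSystem κ ρ t ht₁ ht₂ hm : DiscreteInvSystem Γ_K (k ↦ M_k ⊗ A_{m,k}(ψ))` — the inverse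
  system over `(ℕ, ≤)` attached to a functorial system `t hkk' : M_{k'} → M_k` of morphisms of discrete Galois
  modules (`ht₁`: `t (le_refl) = id`, `ht₂`: `t` composes; for `E`: `P ↦ p^{k'-k} P`);
* `ZpExtension.eisensteinLimitRep … := (eisensteinInvSystem …).limitRep` — **`T_𝔮` as a (jointly continuous,
  compact-coefficient) representation of `Γ_K`** on the limit group, so that `H¹(K, T_𝔮)` is Mathlib's
  `continuousCohomology 1 (eisensteinLimitRep …).toTopRep` and the tree's comparison
  `DiscreteModuleInverseLimitH1` identifies it with the compatible families `cohomologyLimit 1`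
  (the `proj`/`ext`/`surj` of `ZpExtension.EisensteinH1Data`);
* the coefficient action on the limit: `ZpExtension.eisensteinLimitSMul … f : lim →+ lim` (levelwise
  multiplication by `[f] ∈ A_{m,k}`, compatible with the reductions by `eisensteinTwistReduce_mk_smul`),
  `Γ_K`-equivariant (`eisensteinLimitSMul_comm`), additive and multiplicative in `f`
  (`eisensteinLimitSMul_add/_mul/_one`), killed by `q_m` (`eisensteinLimitSMul_qm`) — i.e. `T_𝔮` is an
  `S_𝔮 = Λ/(q_m)`-module with `Γ_K` acting `S_𝔮`-linearly (stated as maps; no `Module` instance is declared).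

Unfolding lemmas: `eisensteinInvSystem_le`, `eisensteinInvSystem_ρ`, `eisensteinInvSystem_red_apply`,
`coe_eisensteinLimitSMul_apply`. BSD is not proved by any of this; nothing about Selmer groups is asserted.

References: [Howard2004HeegnerKolyvagin] B. Howard, Compositio Math. 140 (2004), §2.2, Def. 2.2.3, Lemma 2.2.7,
proof of Thm. 2.2.10; [NeukirchSchmidtWingberg2008] II §7 (2.7.5) (cohomology of limits of discrete modules);
[SerreGaloisCohomology1997] I §2.2.
-/

noncomputable section

open scoped TensorProduct Topology ContRepresentation
open Field Filter

universe u

namespace Literature.NumberTheory.EllipticCurves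

open Literature.NumberTheory.GaloisRepresentations

namespace ZpExtension

/-! ## The level carriers `M_k ⊗ A_{m,k}` as a type synonym with instances -/

section Level

variable {p : ℕ} [hp : Fact p.Prime] {M : ℕ → Type u} [∀ k, AddCommGroup (M k)] {m : ℕ}

/-- **The level-`k` carrier `M_k ⊗ A_{m,k}` of the inverse system**, as a TYPE SYNONYM (a `def`, not an
`abbrev`) of `IwasawaAlgebra.EisensteinCoeff.Twisted p m k (M k)` carrying its own copies of the instances: the
family `k ↦ M_k ⊗ A_{m,k}` must have instances synthesisable UNDER THE BINDER `k` (for `Π k`, `DiscreteInvSystem`),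
which instance resolution cannot do through the pinned `ℤ`-algebra structure inside `Twisted` (it would
re-synthesise `Ideal.instAlgebraQuotient`); a dedicated head symbol avoids the search.
[cite: Howard2004HeegnerKolyvagin, §2.2 (T_𝔮 = lim T_𝔮/p^k T_𝔮)] -/
def EisensteinLevel (p : ℕ) [Fact p.Prime] (m : ℕ) (M : ℕ → Type u) [∀ k, AddCommGroup (M k)] (k : ℕ) : Type u :=
  IwasawaAlgebra.EisensteinCoeff.Twisted p m k (M k)

namespace EisensteinLevel

variable (p) (m) (M)

/-- `M_k ⊗ A_{m,k}` is an abelian group (the instance of `Twisted`). [cite: Howard2004HeegnerKolyvagin, §2.2] -/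
instance instAddCommGroup (k : ℕ) : AddCommGroup (EisensteinLevel p m M k) :=
  inferInstanceAs (AddCommGroup (IwasawaAlgebra.EisensteinCoeff.Twisted p m k (M k)))

/-- `M_k ⊗ A_{m,k}` is an `A_{m,k}`-module (the instance of `Twisted`). [cite: Howard2004HeegnerKolyvagin, §2.2] -/
instance instModule (k : ℕ) : Module (IwasawaAlgebra.EisensteinCoeff p m k) (EisensteinLevel p m M k) :=
  inferInstanceAs (Module (IwasawaAlgebra.EisensteinCoeff p m k) (IwasawaAlgebra.EisensteinCoeff.Twisted p m k (M k)))

/-- The discrete topology on `M_k ⊗ A_{m,k}` (the instance of `Twisted`). [cite: SerreGaloisCohomology1997, I §2.1] -/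
instance instTopologicalSpace (k : ℕ) : TopologicalSpace (EisensteinLevel p m M k) :=
  inferInstanceAs (TopologicalSpace (IwasawaAlgebra.EisensteinCoeff.Twisted p m k (M k)))

/-- `M_k ⊗ A_{m,k}` is discrete. [cite: SerreGaloisCohomology1997, I §2.1] -/
instance instDiscreteTopology (k : ℕ) : DiscreteTopology (EisensteinLevel p m M k) :=
  inferInstanceAs (DiscreteTopology (IwasawaAlgebra.EisensteinCoeff.Twisted p m k (M k)))

/-- `M_k ⊗ A_{m,k}` as a `Λ`-module through `Λ ↠ A_{m,k}` (Mathlib `Module.compHom`; instance on the synonym only):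
`f • x = [f] • x`. [cite: Howard2004HeegnerKolyvagin, §2.2 (T_𝔮 = 𝐓 ⊗_Λ S_𝔮 is a Λ-module through S_𝔮)] -/
instance instModuleIwasawa (k : ℕ) : Module (IwasawaAlgebra p) (EisensteinLevel p m M k) :=
  Module.compHom (EisensteinLevel p m M k)
    (Ideal.Quotient.mk (Ideal.span {(PowerSeries.X ^ m + PowerSeries.C (p : ℤ_[p]) : IwasawaAlgebra p)} ⊔
      Ideal.span {PowerSeries.C ((p : ℤ_[p]) ^ k)}) : IwasawaAlgebra p →+* IwasawaAlgebra.EisensteinCoeff p m k)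

/-- `M_k ⊗ A_{m,k}` as a module over Howard's DVR `S_𝔮 = Λ/(q_m)` through `S_𝔮 ↠ A_{m,k}` (Mathlib `Module.compHom`
along `Ideal.Quotient.lift`; instance on the synonym only): `[f]_{S_𝔮} • x = [f]_{A_{m,k}} • x`.
[cite: Howard2004HeegnerKolyvagin, §2.2 and Def. 2.2.3 (T_𝔮 is an S_𝔮-module)] -/
instance instModuleQuotient (k : ℕ) :
    Module (IwasawaAlgebra p ⧸ Ideal.span {(PowerSeries.X ^ m + PowerSeries.C (p : ℤ_[p]) : IwasawaAlgebra p)})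
      (EisensteinLevel p m M k) :=
  Module.compHom (EisensteinLevel p m M k)
    (Ideal.Quotient.lift (Ideal.span {(PowerSeries.X ^ m + PowerSeries.C (p : ℤ_[p]) : IwasawaAlgebra p)})
      (Ideal.Quotient.mk (Ideal.span {(PowerSeries.X ^ m + PowerSeries.C (p : ℤ_[p]) : IwasawaAlgebra p)} ⊔
        Ideal.span {PowerSeries.C ((p : ℤ_[p]) ^ k)}))
      (fun _ ha ↦ Ideal.Quotient.eq_zero_iff_mem.mpr (Ideal.mem_sup_left ha)) :
      IwasawaAlgebra p ⧸ Ideal.span {(PowerSeries.X ^ m + PowerSeries.C (p : ℤ_[p]) : IwasawaAlgebra p)} →+*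
        IwasawaAlgebra.EisensteinCoeff p m k)

variable {p m M}

/-- Unfolding the `Λ`-action on `M_k ⊗ A_{m,k}`: `f • x = [f]_{A_{m,k}} • x`. [cite: Howard2004HeegnerKolyvagin, §2.2] -/
theorem iwasawa_smul_def (k : ℕ) (f : IwasawaAlgebra p) (x : EisensteinLevel p m M k) :
    f • x = (Ideal.Quotient.mk _ f : IwasawaAlgebra.EisensteinCoeff p m k) • x := rfl

/-- Unfolding the `S_𝔮`-action on `M_k ⊗ A_{m,k}`: `[f]_{S_𝔮} • x = [f]_{A_{m,k}} • x`. [cite: Howard2004HeegnerKolyvagin, §2.2] -/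
theorem quotient_mk_smul_def (k : ℕ) (f : IwasawaAlgebra p) (x : EisensteinLevel p m M k) :
    (Ideal.Quotient.mk (Ideal.span {(PowerSeries.X ^ m + PowerSeries.C (p : ℤ_[p]) : IwasawaAlgebra p)}) f) • x =
      (Ideal.Quotient.mk _ f : IwasawaAlgebra.EisensteinCoeff p m k) • x := by
  show (Ideal.Quotient.lift (Ideal.span {(PowerSeries.X ^ m + PowerSeries.C (p : ℤ_[p]) : IwasawaAlgebra p)})
      (Ideal.Quotient.mk (Ideal.span {(PowerSeries.X ^ m + PowerSeries.C (p : ℤ_[p]) : IwasawaAlgebra p)} ⊔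
        Ideal.span {PowerSeries.C ((p : ℤ_[p]) ^ k)}))
      (fun _ ha ↦ Ideal.Quotient.eq_zero_iff_mem.mpr (Ideal.mem_sup_left ha))
      (Ideal.Quotient.mk _ f) : IwasawaAlgebra.EisensteinCoeff p m k) • x = _
  rw [Ideal.Quotient.lift_mk]

/-- `q_m` acts by zero on every level (the `Λ`-action is through `A_{m,k}`). [cite: Howard2004HeegnerKolyvagin, §2.2] -/
theorem qm_smul_eq_zero (k : ℕ) (x : EisensteinLevel p m M k) :
    (PowerSeries.X ^ m + PowerSeries.C (p : ℤ_[p]) : IwasawaAlgebra p) • x = 0 := by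
  rw [iwasawa_smul_def, Ideal.Quotient.eq_zero_iff_mem.mpr (Ideal.mem_sup_left (Ideal.mem_span_singleton_self _)),
    zero_smul]

/-- The identification `EisensteinLevel p m M k = Twisted p m k (M k)` as an additive isomorphism (the identity).
[cite: Howard2004HeegnerKolyvagin, §2.2] -/
def equivTwisted (k : ℕ) : EisensteinLevel p m M k ≃+ IwasawaAlgebra.EisensteinCoeff.Twisted p m k (M k) :=
  AddEquiv.refl _

/-- `equivTwisted` is the identity map. [cite: Howard2004HeegnerKolyvagin, §2.2] -/
@[simp] theorem equivTwisted_apply (k : ℕ) (x : EisensteinLevel p m M k) :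
    equivTwisted k x = (x : IwasawaAlgebra.EisensteinCoeff.Twisted p m k (M k)) := rfl

end EisensteinLevel

/-- `reduce` along `le_refl` is the identity. [cite: Howard2004HeegnerKolyvagin, §2.2] -/
theorem _root_.Literature.NumberTheory.EllipticCurves.IwasawaAlgebra.EisensteinCoeff.reduce_refl
    (m k : ℕ) (c : IwasawaAlgebra.EisensteinCoeff p m k) :
    IwasawaAlgebra.EisensteinCoeff.reduce p m (le_refl k) c = c := by
  obtain ⟨f, rfl⟩ := Ideal.Quotient.mk_surjective c
  exact IwasawaAlgebra.EisensteinCoeff.reduce_mk m _ f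

/-- `reduce` composes: `reduce_{k ≤ k'} ∘ reduce_{k' ≤ k''} = reduce_{k ≤ k''}`. [cite: Howard2004HeegnerKolyvagin, §2.2] -/
theorem _root_.Literature.NumberTheory.EllipticCurves.IwasawaAlgebra.EisensteinCoeff.reduce_reduce
    (m : ℕ) {a b c : ℕ} (h₁ : a ≤ b) (h₂ : b ≤ c) (x : IwasawaAlgebra.EisensteinCoeff p m c) :
    IwasawaAlgebra.EisensteinCoeff.reduce p m h₁ (IwasawaAlgebra.EisensteinCoeff.reduce p m h₂ x) =
      IwasawaAlgebra.EisensteinCoeff.reduce p m (h₁.trans h₂) x := by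
  obtain ⟨f, rfl⟩ := Ideal.Quotient.mk_surjective x
  rw [IwasawaAlgebra.EisensteinCoeff.reduce_mk, IwasawaAlgebra.EisensteinCoeff.reduce_mk,
    IwasawaAlgebra.EisensteinCoeff.reduce_mk]

end Level

/-! ## The inverse system and its limit -/

section System

variable {K : Type u} [Field K] {p : ℕ} [hp : Fact p.Prime] (κ : ZpExtension K p)
  {M : ℕ → Type u} [∀ k, AddCommGroup (M k)] [∀ k, TopologicalSpace (M k)] [∀ k, DiscreteTopology (M k)]
  (ρ : ∀ k, DiscreteGaloisModule K (M k))
  (t : ∀ ⦃k k' : ℕ⦄, k ≤ k' → ((ρ k').toContRepresentation →ⁱL (ρ k).toContRepresentation))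
  (ht₁ : ∀ (k : ℕ) (x : M k), t (le_refl k) x = x)
  (ht₂ : ∀ ⦃a b c : ℕ⦄ (h₁ : a ≤ b) (h₂ : b ≤ c) (x : M c), t (h₁.trans h₂) x = t h₁ (t h₂ x))
  {m : ℕ} (hm : 1 ≤ m)

/-- **The inverse system `k ↦ M_k ⊗ A_{m,k}(ψ)` of Howard's specialised modules** over `(ℕ, ≤)`, with the
reductions `eisensteinTwistReduce hm hkk' (t hkk')` as transition maps (for `M_k = E[p^k]`, `t = (P ↦ p^{k'-k} P)`:
the system `T_𝔮/p^k T_𝔮` whose limit is `T_𝔮`), in the tree's `DiscreteInvSystem` vocabulary.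
[cite: Howard2004HeegnerKolyvagin, §2.2 and Def. 2.2.3 (T_𝔮 = lim T_𝔮/p^k T_𝔮)] [cite: NeukirchSchmidtWingberg2008, II §7 (2.7.5)] -/
def eisensteinInvSystem :
    DiscreteInvSystem (absoluteGaloisGroup K) (EisensteinLevel p m M) where
  le k k' := k ≤ k'
  le_refl k := le_refl k
  le_trans h₁ h₂ := h₁.trans h₂
  ρ k := (κ.eisensteinTwist (ρ k) hm k : ContinuousRep (absoluteGaloisGroup K) ℤ (EisensteinLevel p m M k))
  red h := ((κ.eisensteinTwistReduce hm h (t h)).toContinuousLinearMap.toLinearMap.toAddMonoidHom :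
    EisensteinLevel p m M _ →+ EisensteinLevel p m M _)
  red_smul h g x := congrArg (fun φ ↦ φ x) ((κ.eisensteinTwistReduce hm h (t h)).isIntertwining' g)
  red_refl k x := by
    change κ.eisensteinTwistReduce hm (le_refl k) (t (le_refl k)) x = x
    induction x using IwasawaAlgebra.EisensteinCoeff.Twisted.induction_on with
    | zero => exact map_zero _
    | tmul c a =>
      rw [eisensteinTwistReduce_tmul, IwasawaAlgebra.EisensteinCoeff.reduce_refl]
      exact congrArg (IwasawaAlgebra.EisensteinCoeff.Twisted.tmul c) (ht₁ k a)
    | add x y hx hy => rw [map_add, hx, hy]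
  red_trans h₁ h₂ x := by
    change κ.eisensteinTwistReduce hm (h₁.trans h₂) (t (h₁.trans h₂)) x =
      κ.eisensteinTwistReduce hm h₁ (t h₁) (κ.eisensteinTwistReduce hm h₂ (t h₂) x)
    induction x using IwasawaAlgebra.EisensteinCoeff.Twisted.induction_on with
    | zero => simp only [map_zero]
    | tmul c a =>
      rw [eisensteinTwistReduce_tmul, eisensteinTwistReduce_tmul, eisensteinTwistReduce_tmul,
        IwasawaAlgebra.EisensteinCoeff.reduce_reduce]
      exact congrArg (IwasawaAlgebra.EisensteinCoeff.Twisted.tmul _) (ht₂ h₁ h₂ a)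
    | add x y hx hy => rw [map_add, map_add, hx, hy, map_add]

/-- The order of `eisensteinInvSystem` is `≤` on `ℕ`. [cite: Howard2004HeegnerKolyvagin, §2.2] -/
@[simp]
theorem eisensteinInvSystem_le (k k' : ℕ) : (κ.eisensteinInvSystem ρ t ht₁ ht₂ hm).le k k' ↔ k ≤ k' := Iff.rfl

/-- The levels of `eisensteinInvSystem` are the modules `eisensteinTwist`. [cite: Howard2004HeegnerKolyvagin, §2.2] -/
theorem eisensteinInvSystem_ρ_apply (k : ℕ) (g : absoluteGaloisGroup K) (x : EisensteinLevel p m M k) :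
    (κ.eisensteinInvSystem ρ t ht₁ ht₂ hm).ρ k g x =
      κ.eisensteinTwist (ρ k) hm k g (x : IwasawaAlgebra.EisensteinCoeff.Twisted p m k (M k)) := rfl

/-- The transition maps of `eisensteinInvSystem` are the reductions `eisensteinTwistReduce`.
[cite: Howard2004HeegnerKolyvagin, §2.2] -/
theorem eisensteinInvSystem_red_apply {k k' : ℕ} (h : k ≤ k') (x : EisensteinLevel p m M k') :
    (κ.eisensteinInvSystem ρ t ht₁ ht₂ hm).red h x =
      κ.eisensteinTwistReduce hm h (t h) (x : IwasawaAlgebra.EisensteinCoeff.Twisted p m k' (M k')) := rfl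

/-- **`Γ_K` acts `Λ`-linearly on each level** (`hlin` for the `Λ`-structure of `EisensteinLevel`).
[cite: Howard2004HeegnerKolyvagin, §2.2 (T_𝔮 is an S_𝔮[Γ_K]-module)] -/
theorem eisensteinInvSystem_ρ_apply_iwasawa_smul (k : ℕ) (σ : absoluteGaloisGroup K) (f : IwasawaAlgebra p)
    (x : EisensteinLevel p m M k) :
    (κ.eisensteinInvSystem ρ t ht₁ ht₂ hm).ρ k σ (f • x) = f • (κ.eisensteinInvSystem ρ t ht₁ ht₂ hm).ρ k σ x :=
  κ.eisensteinTwist_apply_smul (ρ k) hm k σ _ _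

/-- **`Γ_K` acts `S_𝔮`-linearly on each level** (`hlin` for the `S_𝔮 = Λ/(q_m)`-structure of `EisensteinLevel`).
[cite: Howard2004HeegnerKolyvagin, §2.2 (T_𝔮 is an S_𝔮[Γ_K]-module)] -/
theorem eisensteinInvSystem_ρ_apply_quotient_smul (k : ℕ) (σ : absoluteGaloisGroup K)
    (c : IwasawaAlgebra p ⧸ Ideal.span {(PowerSeries.X ^ m + PowerSeries.C (p : ℤ_[p]) : IwasawaAlgebra p)})
    (x : EisensteinLevel p m M k) :
    (κ.eisensteinInvSystem ρ t ht₁ ht₂ hm).ρ k σ (c • x) = c • (κ.eisensteinInvSystem ρ t ht₁ ht₂ hm).ρ k σ x := by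
  obtain ⟨f, rfl⟩ := Ideal.Quotient.mk_surjective c
  rw [EisensteinLevel.quotient_mk_smul_def, EisensteinLevel.quotient_mk_smul_def]
  exact κ.eisensteinTwist_apply_smul (ρ k) hm k σ _ _

/-- **The transition maps are `Λ`-linear.** [cite: Howard2004HeegnerKolyvagin, §2.2] -/
theorem eisensteinInvSystem_red_iwasawa_smul {k k' : ℕ} (h : k ≤ k') (f : IwasawaAlgebra p)
    (x : EisensteinLevel p m M k') :
    (κ.eisensteinInvSystem ρ t ht₁ ht₂ hm).red h (f • x) = f • (κ.eisensteinInvSystem ρ t ht₁ ht₂ hm).red h x :=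
  κ.eisensteinTwistReduce_mk_smul hm h (t h) f _

/-- **The transition maps are `S_𝔮`-linear.** [cite: Howard2004HeegnerKolyvagin, §2.2] -/
theorem eisensteinInvSystem_red_quotient_smul {k k' : ℕ} (h : k ≤ k')
    (c : IwasawaAlgebra p ⧸ Ideal.span {(PowerSeries.X ^ m + PowerSeries.C (p : ℤ_[p]) : IwasawaAlgebra p)})
    (x : EisensteinLevel p m M k') :
    (κ.eisensteinInvSystem ρ t ht₁ ht₂ hm).red h (c • x) = c • (κ.eisensteinInvSystem ρ t ht₁ ht₂ hm).red h x := by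
  obtain ⟨f, rfl⟩ := Ideal.Quotient.mk_surjective c
  rw [EisensteinLevel.quotient_mk_smul_def, EisensteinLevel.quotient_mk_smul_def]
  exact κ.eisensteinTwistReduce_mk_smul hm h (t h) f _

/-- **`T_𝔮` as a continuous representation of `Γ_K`**: the limit representation of `eisensteinInvSystem` on
`lim_k (M_k ⊗ A_{m,k}(ψ))` (subspace topology of the product of the discrete levels — a compact-type
coefficient module). `H¹(K, T_𝔮)` is then Mathlib's `continuousCohomology 1 (eisensteinLimitRep …).toTopRep`,
compared with `lim_k H¹(K, M_k ⊗ A_{m,k}(ψ))` by the tree's `DiscreteModuleInverseLimitH1`.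
[cite: Howard2004HeegnerKolyvagin, §2.2 and Def. 2.2.3 (T_𝔮, H¹(K, T_𝔮))] [cite: NeukirchSchmidtWingberg2008, II §7 (2.7.5)] -/
def eisensteinLimitRep :
    ContinuousRep (absoluteGaloisGroup K) ℤ (κ.eisensteinInvSystem ρ t ht₁ ht₂ hm).limit :=
  (κ.eisensteinInvSystem ρ t ht₁ ht₂ hm).limitRep

/-- Coordinates of the action on `T_𝔮`: levelwise the twisted action. [cite: Howard2004HeegnerKolyvagin, §2.2] -/
@[simp]
theorem coe_eisensteinLimitRep_apply (g : absoluteGaloisGroup K)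
    (x : (κ.eisensteinInvSystem ρ t ht₁ ht₂ hm).limit) (k : ℕ) :
    (κ.eisensteinLimitRep ρ t ht₁ ht₂ hm g x : ∀ k, EisensteinLevel p m M k) k =
      (κ.eisensteinInvSystem ρ t ht₁ ht₂ hm).ρ k g ((x : ∀ k, EisensteinLevel p m M k) k) :=
  rfl

/-! ### The coefficient action of `Λ` on `T_𝔮` -/

/-- **Multiplication by `f ∈ Λ` on `T_𝔮 = lim_k (M_k ⊗ A_{m,k}(ψ))`**: levelwise multiplication by the class
`[f] ∈ A_{m,k}`, compatible with the reductions (`eisensteinTwistReduce_mk_smul`). Through these maps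
`T_𝔮` is an `S_𝔮 = Λ/(q_m)`-module (`eisensteinLimitSMul_add/_mul/_one/_qm`) on which `Γ_K` acts `S_𝔮`-linearly
(`eisensteinLimitSMul_comm`). [cite: Howard2004HeegnerKolyvagin, §2.2 (T_𝔮 is an S_𝔮[Γ_K]-module)] -/
def eisensteinLimitSMul (f : IwasawaAlgebra p) :
    (κ.eisensteinInvSystem ρ t ht₁ ht₂ hm).limit →+ (κ.eisensteinInvSystem ρ t ht₁ ht₂ hm).limit where
  toFun x := ⟨fun k ↦ f • (x : ∀ k, EisensteinLevel p m M k) k, fun _ _ h ↦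
    (κ.eisensteinInvSystem_red_iwasawa_smul ρ t ht₁ ht₂ hm h f _).trans
      (congrArg (fun y ↦ f • y) ((κ.eisensteinInvSystem ρ t ht₁ ht₂ hm).red_apply_coe x h))⟩
  map_zero' := Subtype.ext (funext fun _ ↦ smul_zero f)
  map_add' _ _ := Subtype.ext (funext fun _ ↦ smul_add f _ _)

/-- Coordinates of the coefficient action: `(f · x)_k = f • x_k = [f]_{A_{m,k}} • x_k`. [cite: Howard2004HeegnerKolyvagin, §2.2] -/
@[simp]
theorem coe_eisensteinLimitSMul_apply (f : IwasawaAlgebra p) (x : (κ.eisensteinInvSystem ρ t ht₁ ht₂ hm).limit)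
    (k : ℕ) :
    (κ.eisensteinLimitSMul ρ t ht₁ ht₂ hm f x : ∀ k, EisensteinLevel p m M k) k =
      f • (x : ∀ k, EisensteinLevel p m M k) k :=
  rfl

/-- The coefficient action commutes with `Γ_K` (`Γ_K` acts `Λ`-linearly on `T_𝔮`).
[cite: Howard2004HeegnerKolyvagin, §2.2 (T_𝔮 is an S_𝔮[Γ_K]-module)] -/
theorem eisensteinLimitSMul_comm (f : IwasawaAlgebra p) (g : absoluteGaloisGroup K)
    (x : (κ.eisensteinInvSystem ρ t ht₁ ht₂ hm).limit) :
    κ.eisensteinLimitSMul ρ t ht₁ ht₂ hm f (κ.eisensteinLimitRep ρ t ht₁ ht₂ hm g x) =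
      κ.eisensteinLimitRep ρ t ht₁ ht₂ hm g (κ.eisensteinLimitSMul ρ t ht₁ ht₂ hm f x) :=
  Subtype.ext (funext fun k ↦ (κ.eisensteinInvSystem_ρ_apply_iwasawa_smul ρ t ht₁ ht₂ hm k g f _).symm)

/-- Additivity in the scalar: `(f + f') · x = f · x + f' · x`. [cite: Howard2004HeegnerKolyvagin, §2.2] -/
theorem eisensteinLimitSMul_add (f f' : IwasawaAlgebra p) (x : (κ.eisensteinInvSystem ρ t ht₁ ht₂ hm).limit) :
    κ.eisensteinLimitSMul ρ t ht₁ ht₂ hm (f + f') x =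
      κ.eisensteinLimitSMul ρ t ht₁ ht₂ hm f x + κ.eisensteinLimitSMul ρ t ht₁ ht₂ hm f' x :=
  Subtype.ext (funext fun _ ↦ add_smul f f' _)

/-- Multiplicativity in the scalar: `(f f') · x = f · (f' · x)`. [cite: Howard2004HeegnerKolyvagin, §2.2] -/
theorem eisensteinLimitSMul_mul (f f' : IwasawaAlgebra p) (x : (κ.eisensteinInvSystem ρ t ht₁ ht₂ hm).limit) :
    κ.eisensteinLimitSMul ρ t ht₁ ht₂ hm (f * f') x =
      κ.eisensteinLimitSMul ρ t ht₁ ht₂ hm f (κ.eisensteinLimitSMul ρ t ht₁ ht₂ hm f' x) :=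
  Subtype.ext (funext fun _ ↦ mul_smul f f' _)

/-- `1 · x = x`. [cite: Howard2004HeegnerKolyvagin, §2.2] -/
theorem eisensteinLimitSMul_one (x : (κ.eisensteinInvSystem ρ t ht₁ ht₂ hm).limit) :
    κ.eisensteinLimitSMul ρ t ht₁ ht₂ hm 1 x = x :=
  Subtype.ext (funext fun _ ↦ one_smul _ _)

/-- **`q_m = T^m + p` kills `T_𝔮`** (it is an `S_𝔮 = Λ/(q_m)`-module). [cite: Howard2004HeegnerKolyvagin, §2.2 (T_𝔮 = 𝐓 ⊗_Λ S_𝔮)] -/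
theorem eisensteinLimitSMul_qm (x : (κ.eisensteinInvSystem ρ t ht₁ ht₂ hm).limit) :
    κ.eisensteinLimitSMul ρ t ht₁ ht₂ hm (PowerSeries.X ^ m + PowerSeries.C (p : ℤ_[p])) x = 0 :=
  Subtype.ext (funext fun k ↦ EisensteinLevel.qm_smul_eq_zero k _)

/-- Scalars congruent modulo `q_m` act identically: the action factors through `S_𝔮 = Λ/(q_m)`.
[cite: Howard2004HeegnerKolyvagin, §2.2] -/
theorem eisensteinLimitSMul_eq_of_sub_mem_span_qm {f f' : IwasawaAlgebra p}
    (hff' : f - f' ∈ Ideal.span {(PowerSeries.X ^ m + PowerSeries.C (p : ℤ_[p]) : IwasawaAlgebra p)})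
    (x : (κ.eisensteinInvSystem ρ t ht₁ ht₂ hm).limit) :
    κ.eisensteinLimitSMul ρ t ht₁ ht₂ hm f x = κ.eisensteinLimitSMul ρ t ht₁ ht₂ hm f' x := by
  obtain ⟨c, hc⟩ := Ideal.mem_span_singleton'.mp hff'
  have h0 : κ.eisensteinLimitSMul ρ t ht₁ ht₂ hm (f - f') x = 0 := by
    rw [← hc, eisensteinLimitSMul_mul, eisensteinLimitSMul_qm, map_zero]
  have hf : f = f' + (f - f') := by ring
  conv_lhs => rw [hf]
  rw [eisensteinLimitSMul_add, h0, add_zero]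

end System

end ZpExtension

end Literature.NumberTheory.EllipticCurves

end
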